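import Literature.Computability.MetaComplexity.BoundedArithPow2
import Literature.Computability.MetaComplexity.BoundedArithTheoriesProofs
import HarnessLib

/-!
# `T₂ʲ ⊆ S₂ʲ⁺¹`: `Σᵇⱼ`-induction in models of `BASIC + Σᵇⱼ₊₁-PIND`

Topic `Literature/Computability/MetaComplexity` (companion of `BoundedArithTheories.lean`,
`BoundedArithModels.lean`, `BoundedArithDefinability.lean`, `BoundedArithPow2.lean`).  We
discharge the named fact `T2_extends_S2_succ` of `BoundedArithTheories.lean` — "`S₂ʲ⁺¹` proves
every axiom of `T₂ʲ`", i.e. the `Σᵇⱼ₊₁-PIND` axioms imply the `Σᵇⱼ-IND` axioms over `BASIC`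
(Buss 1986; Buss 1990, §1, p. 3; Krajíček 1995, Lemma 5.2.8: `T₂ⁱ ⊆ S₂ⁱ⁺¹`) — for every `j ≥ 0`,
semantically (provability is Mathlib's `⊨ᵇ`): in a structure `M ⊨ BASIC + Σᵇⱼ₊₁-PIND`, ordinary
induction holds for every predicate `Σᵇⱼ`-definable with parameters
(`BASICModel.ind_of_pind_succ`); hence a model of `S₂ʲ⁺¹` is a model of `T₂ʲ`
(`model_T2_of_model_S2_succ`) and `T2_extends_S2_succ_holds`.

## The argument

A dyadic binary search — the "shortening of cuts" / "divide and conquer" proof (Krajíček 1995,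
proof of Lemma 5.2.8, p. 68; Buss 1990, §1) arranged so that neither subtraction nor `MSP` nor
sequence coding (i.e. none of the bootstrapping of `S₂¹`) is used, only `BASIC`.  Suppose `A(0)`,
`∀x (A(x) → A(x+1))` and `¬A(a)`, and put `A'(x) :≡ x ≤ a ∧ A(x)`.  By `Σᵇⱼ₊₁-PIND` on `c` we
prove `|c| ≤ |a| + 1 → D(c)` for the `Σᵇⱼ₊₁` formula

  `D(c) :≡ ∃m ≤ a ∃q ≤ 1#(2a+1) [Pow(q) ∧ |q| + |c| = |a| + 2 ∧ A'(m·q) ∧ ¬A'(m·q + q)]`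

(`Pow` is Krajíček's predicate "power of two" of `BoundedArithPow2.lean`; `¬A'` is `Σᵇⱼ₊₁` as
the negation of a `Πᵇⱼ₊₁` formula): for `c = 0` take `m = 0` and `q = 1#(2a+1) = 2^{|a|+1} > a`;
in the induction step (`|c| = |⌊c/2⌋| + 1`) the power of two is halved, `q = 2q'` with `Pow(q')`
(`BASICModel.IsPow.eq_two_mul_mHalf`, a consequence of `BASIC` alone), and `m` becomes `2m + 1`
or `2m` according as `A'((2m+1)·q')` holds or not.  At `c = 2a + 1`, where `|c| = |a| + 1`, we
get `|q| = 1`, `q = 1`, i.e. `A'(m) ∧ ¬A'(m + 1)` for some `m ≤ a`, contradicting the induction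
step of `A`.  The only other induction used is `Σᵇ₁-PIND` (available by cumulativity) showing
that `1#y` is a power of two (`BASICModel.isPow_one_mSmash`).  Multiplication is used only
through the distributive laws (its associativity is not available in `BASIC`).

## Main statements

* `BASICModel.IsPow.eq_two_mul_mHalf`: in a model of `BASIC`, a power of two `q ≠ 1` is `2·⌊q/2⌋`
  with `⌊q/2⌋` a power of two;
* `BASICModel.isPow_one_mSmash`: in a model of `BASIC + Σᵇ₁-PIND`, `1#y` is a power of two;
* `BASICModel.ind_of_pind_succ`: **`Σᵇⱼ-IND` in models of `BASIC + Σᵇⱼ₊₁-PIND`**;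
* `ind_of_model_S2_succ`, `model_T2_of_model_S2_succ`: a model of `S₂ʲ⁺¹` satisfies `Σᵇⱼ-IND`,
  hence is a model of `T₂ʲ`;
* `T2_extends_S2_succ_holds`: discharge of `T2_extends_S2_succ` (Buss 1990, §1, p. 3;
  Krajíček 1995, Lemma 5.2.8).

## References

* S. R. Buss, *Axiomatizations and conservation results for fragments of bounded arithmetic*,
  in: Logic and Computation, Contemp. Math. 106, AMS 1990, pp. 57–84, §1 (p. 3: "the
  `Σᵇᵢ₊₁-PIND` axioms imply the `Σᵇᵢ-IND` axioms. Hence the theory `S₂ⁱ⁺¹` contains `T₂ⁱ`").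
* J. Krajíček, *Bounded Arithmetic, Propositional Logic and Complexity Theory*, CUP 1995,
  Lemma 5.2.8 (p. 68): `S₂ⁱ ⊆ T₂ⁱ ⊆ S₂ⁱ⁺¹`.
* S. R. Buss, *Bounded Arithmetic*, Bibliopolis 1986, Ch. 2.

## Design choices

* Everything is proved in an arbitrary structure `M ⊨ BASIC` carrying the scheme
  `Σᵇⱼ₊₁-PIND` (instance argument `[M ⊨ BASIC]`, hypothesis `M ⊨ PINDScheme (sigmabFormulas (j+1))`),
  in the algebraic notation of `BoundedArithAlgebra.lean` (namespace `BASICModel`), and then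
  specialised to models of `S₂ʲ⁺¹ = BASIC + Σᵇⱼ₊₁-PIND`.
* The case `j = 0` (`T₂⁰ ⊆ S₂¹`) is included: the argument is uniform in `j`.
-/

namespace Literature.Computability.MetaComplexity

open FirstOrder FirstOrder.Language

/-! ## A `Σᵇᵢ` formula with parameters defines a `Σᵇᵢ`-definable predicate -/

/-- A `Σᵇᵢ` formula `ψ(p̄, x)` with variables `Fin (k + 1)`, at fixed parameters `p̄ ∈ Mᵏ`,
defines a `Σᵇᵢ`-definable (with parameters) unary predicate of its last variable — the converse
bookkeeping to `exists_formula_fin_of_isSigmabDef` (Buss 1986, §2.1: formulas with parameters).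
[cite: Buss1986, §2.1] -/
theorem IsSigmab.isSigmabDef_realize_snoc {M : Type} [Language.boundedArith.Structure M]
    {k i : ℕ} {ψ : Language.boundedArith.Formula (Fin (k + 1))} (hψ : IsSigmab i ψ)
    (p : Fin k → M) : IsSigmabDef i fun v : Fin 1 → M => ψ.Realize (Fin.snoc p (v 0)) := by
  refine ⟨ψ.relabel (Fin.lastCases (Sum.inr 0) fun l => Sum.inl (p l)), hψ.formulaRelabel _,
    fun xs => ?_⟩
  have h : (Fin.snoc p (xs 0) : Fin (k + 1) → M) =
      argEnv xs ∘ Fin.lastCases (Sum.inr 0) fun l => Sum.inl (p l) := by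
    funext l
    cases l using Fin.lastCases with
    | last => simp
    | cast l => simp
  rw [Formula.realize_relabel, ← h]

namespace BASICModel

variable {M : Type} [Language.boundedArith.Structure M] [hB : M ⊨ BASIC]

/-! ## Powers of two in models of `BASIC`: halving -/

section Pow

/-- **Halving a power of two** (in a model of `BASIC`): a power of two `q ≠ 1` is even,
`q = 2·⌊q/2⌋`, and `⌊q/2⌋` is again a power of two.  (If `q = x + 1` with `|x| + 1 = |q|` then
`q` is even — an odd `2h + 1`, `h ≠ 0`, has `|2h| = |2h + 1|` — so `x = 2x' + 1`, `x' + 1 = ⌊q/2⌋`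
and `|x'| + 1 = |⌊q/2⌋|` by axioms 10 and 32 of `BASIC`.) [folklore] -/
theorem IsPow.eq_two_mul_mHalf {q : M} (hq : IsPow q) (hq1 : q ≠ 1) :
    q = 2 * mHalf q ∧ IsPow (mHalf q) := by
  have hq0 : q ≠ 0 := hq.ne_zero
  obtain ⟨x, -, hxq, hx⟩ := hq
  -- `q` is even
  have heven : 2 * mHalf q = q := by
    rcases two_mul_mHalf_or q with h | h
    · exact h
    · exfalso
      have hx2 : x = 2 * mHalf q := add_right_cancel (hxq.trans h.symm)
      rcases eq_or_ne (mHalf q) 0 with h0 | h0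
      · apply hq1
        rw [← h, h0, mul_zero, zero_add]
      · have hlenq : mLen q = mLen (mHalf q) + 1 := by
          rw [← mLen_two_mul_add_one (mHalf q), h]
        rw [hx2, BASICModel.mLen_two_mul h0, hlenq] at hx
        exact ne_add_one _ hx.symm
  have h0 : mHalf q ≠ 0 := by
    intro h0
    apply hq0
    rw [← heven, h0, mul_zero]
  refine ⟨heven.symm, ?_⟩
  -- `x` is odd
  rcases two_mul_mHalf_or x with hxe | hxo
  · exact absurd (by rw [heven, ← hxq, hxe]) (two_mul_ne_two_mul_add_one (mHalf q) (mHalf x))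
  · have h2 : 2 * (mHalf x + 1) = 2 * mHalf q :=
      calc 2 * (mHalf x + 1) = 2 * mHalf x + 1 + 1 := by
            rw [mul_add, mul_one, add_assoc, one_add_one_eq_two]
        _ = q := by rw [hxo, hxq]
        _ = 2 * mHalf q := heven.symm
    have hx' : mHalf x + 1 = mHalf q := two_mul_cancel h2
    refine ⟨mHalf x, ?_, hx', ?_⟩
    · rw [← hx']
      exact le_add_right'' _ _
    · have e1 : mLen x = mLen (mHalf x) + 1 := by rw [← mLen_two_mul_add_one (mHalf x), hxo]
      have e2 : mLen q = mLen (mHalf q) + 1 := by rw [← BASICModel.mLen_two_mul h0, heven]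
      rw [e1, e2] at hx
      exact add_right_cancel hx

/-- A power of two of length `1` is `1` (in a model of `BASIC`). [folklore] -/
theorem IsPow.eq_one_of_mLen_eq_one {q : M} (hq : IsPow q) (h : mLen q = 1) : q = 1 :=
  hq.eq_of_mLen_eq isPow_one (by rw [h, mLen_one])

/-- `|1 # y| = |y| + 1` (axioms 11, 13 of `BASIC`). [cite: Buss1986, §2.2] -/
theorem mLen_one_mSmash (y : M) : mLen (mSmash 1 y) = mLen y + 1 := by
  rw [mLen_mSmash, mLen_one, one_mul]

/-- **`1 # y = 2^{|y|}` is a power of two**, in a model of `BASIC + Σᵇ₁-PIND`: by `Σᵇ₁-PIND` on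
`y`, using `1 # 0 = 1`, `1 # 1 = 2` and `1 # (2x) = 1 # (2x+1) = 2·(1 # x)` for `x ≠ 0`
(axioms 14, 15). [folklore] -/
theorem isPow_one_mSmash (hP : M ⊨ PINDScheme (sigmabFormulas 1)) (y : M) :
    IsPow (mSmash 1 y) := by
  refine IsSigmabDef.pinduction' hP (P := fun y => IsPow (mSmash 1 y))
    (isSigmabDef_isPow.comp₁ ((IsTermFn.const 1).smash (IsTermFn.proj 0))) ?_ ?_ y
  · rw [mZero_eq, mSmash_zero]
    exact isPow_one
  · intro b ih
    rcases eq_or_ne (mHalf b) 0 with h0 | h0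
    · rcases two_mul_mHalf_or b with h | h
      · rw [← h, h0, mul_zero, mSmash_zero]
        exact isPow_one
      · rw [← h, h0, mul_zero, zero_add, one_mSmash_one]
        simpa using (isPow_one (M := M)).two_mul
    · rcases two_mul_mHalf_or b with h | h
      · rw [← h, one_mSmash_two_mul h0]
        exact ih.two_mul
      · rw [← h, one_mSmash_two_mul_add_one' h0]
        exact ih.two_mul

end Pow

/-! ## `Σᵇⱼ`-induction from `Σᵇⱼ₊₁`-polynomial induction -/

section Bisection

/-- The search predicate of the binary-search argument is `Σᵇⱼ₊₁`-definable with parameters: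
for `A ∈ Σᵇⱼ` (with parameters) and parameters `a, Q, L`,
`D(c) :≡ ∃m ≤ a ∃q ≤ Q [Pow(q) ∧ |q| + |c| = L ∧ (m·q ≤ a ∧ A(m·q)) ∧ ¬(m·q + q ≤ a ∧ A(m·q + q))]`
is `Σᵇⱼ₊₁` (the last conjunct being the negation of a `Πᵇⱼ₊₁` formula; Buss 1986, §2.1).
[folklore] -/
theorem isSigmabDef_bisect {j : ℕ} {A : M → Prop}
    (hA : IsSigmabDef j fun v : Fin 1 → M => A (v 0)) (a Q L : M) :
    IsSigmabDef (j + 1) fun v : Fin 1 → M =>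
      ∃ m, m ≤ a ∧ ∃ q, q ≤ Q ∧ (IsPow q ∧ mLen q + mLen (v 0) = L ∧
        ((m * q ≤ a ∧ A (m * q)) ∧ ¬(m * q + q ≤ a ∧ A (m * q + q)))) := by
  have hle : IsQFDef fun v : Fin 1 → M => v 0 ≤ a := isQFDef_le (IsTermFn.proj 0) (IsTermFn.const a)
  have hA' : IsSigmabDef (j + 1) fun v : Fin 1 → M => v 0 ≤ a ∧ A (v 0) :=
    (hle.isSigmabDef (j + 1)).and (hA.mono (Nat.le_succ j))
  have hnA' : IsSigmabDef (j + 1) fun v : Fin 1 → M => ¬(v 0 ≤ a ∧ A (v 0)) :=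
    ((hle.isPibDef (j + 1)).and hA.isPibDef_succ).not
  have h3 : IsSigmabDef (j + 1) fun u : Fin 3 → M =>
      IsPow (u 2) ∧ mLen (u 2) + mLen (u 0) = L ∧
        ((u 1 * u 2 ≤ a ∧ A (u 1 * u 2)) ∧ ¬(u 1 * u 2 + u 2 ≤ a ∧ A (u 1 * u 2 + u 2))) :=
    ((isSigmabDef_isPow.comp₁ (IsTermFn.proj 2)).mono (Nat.succ_le_succ (Nat.zero_le j))).and
      (((isQFDef_eq (isTermFn_add (isTermFn_mLen (IsTermFn.proj 2))
          (isTermFn_mLen (IsTermFn.proj 0))) (IsTermFn.const L)).isSigmabDef (j + 1)).and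
        ((hA'.comp₁ (P := fun x => x ≤ a ∧ A x) (isTermFn_mul (IsTermFn.proj 1) (IsTermFn.proj 2))).and
          (hnA'.comp₁ (P := fun x => ¬(x ≤ a ∧ A x))
            (isTermFn_add (isTermFn_mul (IsTermFn.proj 1) (IsTermFn.proj 2)) (IsTermFn.proj 2)))))
  have h2 : IsSigmabDef (j + 1) fun w : Fin 2 → M =>
      ∃ q, q ≤ Q ∧ (IsPow q ∧ mLen q + mLen (w 0) = L ∧
        ((w 1 * q ≤ a ∧ A (w 1 * q)) ∧ ¬(w 1 * q + q ≤ a ∧ A (w 1 * q + q)))) :=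
    (IsSigmabDef.bexLE (i := j) h3 (IsTermFn.const Q)).of_iff fun w => by simp
  exact (IsSigmabDef.bexLE (i := j) h2 (IsTermFn.const a)).of_iff fun v => by simp

/-- **`Σᵇⱼ-IND` in models of `BASIC + Σᵇⱼ₊₁-PIND`** (`T₂ʲ ⊆ S₂ʲ⁺¹`: Buss 1990, §1, p. 3, "the
`Σᵇᵢ₊₁-PIND` axioms imply the `Σᵇᵢ-IND` axioms"; Krajíček 1995, Lemma 5.2.8): if `A ⊆ M` is
`Σᵇⱼ`-definable with parameters, `A(0)` and `∀x (A(x) → A(x + 1))`, then `A = M`.  Proof: the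
dyadic binary search described in the module docstring — `Σᵇⱼ₊₁-PIND` on `c` for
`|c| ≤ |a| + 1 → D(c)` with `D` as in `isSigmabDef_bisect` (`Q = 1#(2a+1)`, `L = |a| + 2`), then
`c = 2a + 1`. [cite: BussContempMath1990, §1 (p. 3)] -/
theorem ind_of_pind_succ {j : ℕ} (hP : M ⊨ PINDScheme (sigmabFormulas (j + 1))) {A : M → Prop}
    (hA : IsSigmabDef j fun v : Fin 1 → M => A (v 0)) (h0 : A 0) (hs : ∀ x, A x → A (x + 1))
    (a : M) : A a := by
  by_contra hna
  have hP1 : M ⊨ PINDScheme (sigmabFormulas 1) :=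
    hP.mono (PINDScheme_mono (sigmabFormulas_mono_holds (Nat.succ_le_succ (Nat.zero_le j))))
  -- the bound `Q = 1 # (2a + 1) = 2^{|a| + 1} > a`
  have hQpow : IsPow (mSmash 1 (2 * a + 1)) := isPow_one_mSmash hP1 _
  have hQlen : mLen (mSmash 1 (2 * a + 1)) = mLen a + 1 + 1 := by
    rw [mLen_one_mSmash, mLen_two_mul_add_one]
  have haQ : a < mSmash 1 (2 * a + 1) :=
    lt_of_mLen_lt_mLen (by rw [hQlen]; exact (lt_add_one' _).trans_le (le_add_right'' _ _))
  -- the binary search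
  have key : ∀ c, mLen c ≤ mLen a + 1 →
      ∃ m, m ≤ a ∧ ∃ q, q ≤ mSmash 1 (2 * a + 1) ∧ (IsPow q ∧ mLen q + mLen c = mLen a + 1 + 1 ∧
        ((m * q ≤ a ∧ A (m * q)) ∧ ¬(m * q + q ≤ a ∧ A (m * q + q)))) := by
    intro c
    refine IsSigmabDef.pinduction' hP
      (P := fun c => mLen c ≤ mLen a + 1 →
        ∃ m, m ≤ a ∧ ∃ q, q ≤ mSmash 1 (2 * a + 1) ∧ (IsPow q ∧ mLen q + mLen c = mLen a + 1 + 1 ∧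
          ((m * q ≤ a ∧ A (m * q)) ∧ ¬(m * q + q ≤ a ∧ A (m * q + q)))))
      (IsSigmabDef.imp ((isQFDef_le (isTermFn_mLen (IsTermFn.proj 0))
        (IsTermFn.const (mLen a + 1))).isPibDef (j + 1)) (isSigmabDef_bisect hA a _ _)) ?_ ?_ c
    · -- `c = 0`: `m = 0`, `q = Q`
      intro _
      refine ⟨0, bot_le, mSmash 1 (2 * a + 1), le_rfl, hQpow, ?_, ?_, ?_⟩
      · rw [mZero_eq, mLen_zero, add_zero, hQlen]
      · rw [zero_mul]
        exact ⟨bot_le, h0⟩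
      · rw [zero_mul, zero_add]
        exact fun h => haQ.not_ge h.1
    · -- `⌊c/2⌋ ↦ c`: halve `q`, refine `m`
      intro c ih hc
      rcases eq_or_ne c 0 with rfl | hc0
      · rw [mHalf_zero] at ih
        exact ih hc
      have hlen : mLen c = mLen (mHalf c) + 1 := mLen_eq_mLen_mHalf_add_one hc0
      have hc' : mLen (mHalf c) ≤ mLen a := by
        rw [hlen] at hc
        exact le_of_add_le_add_right hc
      obtain ⟨m, -, q, hqQ, hq, hql, hAm, hnAm⟩ := ih (hc'.trans (le_add_right'' _ _))
      have hq1 : q ≠ 1 := by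
        rintro rfl
        rw [mLen_one, add_comm (1 : M)] at hql
        have h' : mLen (mHalf c) = mLen a + 1 := add_right_cancel hql
        rw [h'] at hc'
        exact (lt_add_one' _).not_ge hc'
      obtain ⟨hqe, hq'⟩ := hq.eq_two_mul_mHalf hq1
      have hq'0 : mHalf q ≠ 0 := hq'.ne_zero
      have hqq : q = mHalf q + mHalf q := by rw [← two_mul]; exact hqe
      have hql' : mLen (mHalf q) + mLen c = mLen a + 1 + 1 := by
        rw [← hql, hlen]
        conv_rhs => rw [hqe, mLen_two_mul hq'0]
        rw [add_assoc, add_comm (mLen (mHalf c)) 1]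
      have e0 : (m + m) * mHalf q = m * q := by rw [add_mul, ← mul_add, ← hqq]
      have e1 : (m + m + 1) * mHalf q = m * q + mHalf q := by rw [add_mul, e0, one_mul]
      have e1' : (m + m) * mHalf q + mHalf q = (m + m + 1) * mHalf q := by
        rw [add_mul (m + m) 1, one_mul]
      have e2 : (m + m + 1) * mHalf q + mHalf q = m * q + q := by rw [e1, add_assoc, ← hqq]
      have hq'Q : mHalf q ≤ mSmash 1 (2 * a + 1) := (mHalf_le q).trans hqQ
      have hle : ∀ n : M, n ≤ n * mHalf q := fun n => by
        simpa using mul_le_mul'' (le_refl n) ((one_le_iff_ne_zero' _).2 hq'0)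
      by_cases hmid : (m + m + 1) * mHalf q ≤ a ∧ A ((m + m + 1) * mHalf q)
      · refine ⟨m + m + 1, (hle _).trans hmid.1, mHalf q, hq'Q, hq', hql', hmid, ?_⟩
        rw [e2]
        exact hnAm
      · refine ⟨m + m, (hle _).trans ?_, mHalf q, hq'Q, hq', hql', ?_, ?_⟩
        · rw [e0]
          exact hAm.1
        · rw [e0]
          exact hAm
        · rw [e1']
          exact hmid
  -- conclusion at `c = 2a + 1`
  obtain ⟨m, -, q, -, hq, hql, hAm, hnAm⟩ := key (2 * a + 1) (by rw [mLen_two_mul_add_one])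
  rw [mLen_two_mul_add_one, add_comm (mLen q)] at hql
  have hq1 : q = 1 := hq.eq_one_of_mLen_eq_one (add_left_cancel hql)
  subst hq1
  rw [mul_one] at hAm hnAm
  have hm1 : ¬(m + 1 ≤ a) := fun h => hnAm ⟨h, hs m hAm.2⟩
  have hma : a ≤ m := (lt_add_one_iff' a m).1 (not_le.1 hm1)
  exact hna (le_antisymm hAm.1 hma ▸ hAm.2)

end Bisection

end BASICModel

/-! ## Models of `S₂ʲ⁺¹` are models of `T₂ʲ` -/

section Models

open BASICModel

variable {M : Type} [Language.boundedArith.Structure M] {j : ℕ}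

/-- **`Σᵇⱼ-IND` in models of `S₂ʲ⁺¹`**: in a model of `S₂ʲ⁺¹`, induction holds for every
predicate `Σᵇⱼ`-definable with parameters (Buss 1990, §1, p. 3; Krajíček 1995, Lemma 5.2.8).
[cite: BussContempMath1990, §1 (p. 3)] -/
theorem ind_of_model_S2_succ (hM : M ⊨ S2 (j + 1)) {A : M → Prop}
    (hA : IsSigmabDef j fun v : Fin 1 → M => A (v 0)) (h0 : A (mZero M))
    (hs : ∀ x, A x → A (mSucc x)) (a : M) : A a := by
  haveI : M ⊨ BASIC := model_BASIC_of_model_S2 hM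
  exact ind_of_pind_succ (hM.mono Set.subset_union_right) hA h0
    (fun x hx => by rw [← mSucc_eq]; exact hs x hx) a

/-- **A model of `S₂ʲ⁺¹` is a model of `T₂ʲ`** (`T₂ʲ ⊆ S₂ʲ⁺¹`; Buss 1990, §1, p. 3; Krajíček 1995,
Lemma 5.2.8): it satisfies `BASIC` and, by `ind_of_model_S2_succ`, every `Σᵇⱼ-IND` axiom.
[cite: Krajicek1995, Lemma 5.2.8 (p. 68)] -/
theorem model_T2_of_model_S2_succ (hM : M ⊨ S2 (j + 1)) : M ⊨ T2 j := by
  refine ⟨fun φ hφ => ?_⟩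
  rcases hφ with hφ | hφ
  · exact hM.realize_of_mem φ (BASIC_subset_S2 _ hφ)
  · simp only [INDScheme, Set.mem_iUnion, Set.mem_image] at hφ
    obtain ⟨k, ψ, hψ, rfl⟩ := hφ
    rw [realize_indAxiom_iff]
    intro p h0 hs a
    exact ind_of_model_S2_succ hM (hψ.isSigmabDef_realize_snoc p) h0 hs a

end Models

/-- **Discharge of `T2_extends_S2_succ`**: for every `j`, `S₂ʲ⁺¹` extends `T₂ʲ` — every axiom
of `T₂ʲ` (the axioms of `BASIC` and the `Σᵇⱼ-IND` axioms) is a consequence (`⊨ᵇ`) of `S₂ʲ⁺¹`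
(Buss 1986; Buss 1990, §1, p. 3; Krajíček 1995, Lemma 5.2.8). [cite: BussContempMath1990, §1 (p. 3)] -/
theorem T2_extends_S2_succ_holds : T2_extends_S2_succ := by
  intro j φ hφ
  rw [Theory.models_sentence_iff]
  intro N
  haveI : (N : Type) ⊨ T2 j := model_T2_of_model_S2_succ N.is_model
  exact Theory.realize_sentence_of_mem (T2 j) hφ

end Literature.Computability.MetaComplexity
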